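import Mathlib
import Summits.ResolutionOfSingularities.ResolutionOfSingularities.Theorems.CleanModels.Negative.CossartPiltant2019Thm15iFrameOrdTowerCurveCentre
import HarnessLib

/-!
# Towards `CurveBlowupFacts 5`: the chart `R[v/u₀]` of a curve blow-up and quasi-regularity

Support file (INPUTS seat res-inputs-p-cp15frame g2, 2026-08-28) for the residual hypothesis `CurveBlowupFacts 5` of
`CossartPiltant2019_thm_1_5_i_frame_false_of_curveBlowupFacts` (RETIRED statement F-110, crux `CleanModels`,
stmt-ResolutionOfSingularities-15917).  For a regular system of parameters `x = (u₀, v, w)` of `R = range (S → K)`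
(`OrdWitness.exists_rsop_of_curveCentre`, file `…OrdTowerCurveCentre`) we study, inside `K`,

* `OrdWitness.theta x = v/u₀`, the chart algebra `OrdWitness.chart x = R[v/u₀]` and the curve blow-up
  `OrdWitness.Bsharp x = R[v/u₀]_{centre of O}` (`O = ord_𝔪`); `chart x ≤ Bsharp x ≤ O`, `Bsharp x` is local and DOMINATED:
  `𝔪 = {ord > 0}`;
* `OrdWitness.exists_aeval_of_mem_chart` — every element of `R[v/u₀]` is `f(v/u₀)` for a polynomial `f ∈ R[T]`;
* `OrdWitness.homog N f` — the form `Σ fᵢ X₁^i X₀^{N-i}` with `u₀^N · f(v/u₀) = homog N f (u₀, v, w)` (`coe_eval_homog`);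
* **QUASI-REGULARITY IN THE CHART** (`OrdWitness.coeff_mem_maximalIdeal_of_ordVK_aeval_lt_one`, from the tree's Matsumura 17.10
  `coeff_mem_maximalIdeal_of_eval_mem_pow`): `ord f(v/u₀) > 0 ⟹` every coefficient of `f` lies in `𝔪_R`; conversely
  (`ordVK_aeval_lt_one_of_coeff_mem`); hence a polynomial with some unit coefficient has `ord f(v/u₀) = 0`
  (the residue of `v/u₀` is transcendental over `𝔽_p`).

Nothing here proves or refutes resolution of singularities in characteristic `p`; [OURS · NEGATIVE-SUPPORT] counted 0.
-/

noncomputable section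

set_option linter.dupNamespace false -- mandated namespace of this single-conjunct summit

open MvPolynomial IsLocalRing
open Literature.AlgebraicGeometry.Resolution Literature.AlgebraicGeometry.Resolution.WeightedBlowup

namespace Summit.ResolutionOfSingularities.ResolutionOfSingularities.Theorems.CleanModels.Negative

namespace OrdWitness

variable (p : ℕ) [hp : Fact p.Prime]

/-! ## 1. Members of a regular system of parameters of `range (S → K)` -/

section rsop

variable {p}
variable {x : Fin 3 → Rg p} (hx : Ideal.span (Set.range x) = maximalIdeal (Rg p))

include hx in
/-- A triple generating `𝔪_R` is a regular system of parameters (`emb dim R = 3`). [folklore] -/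
theorem isRsopPart_of_span_eq : IsRsopPart x := by
  refine ⟨inferInstance, 0, Fin.elim0, by rw [ringKrullDim_range]; rfl, ?_⟩
  rw [Set.range_eq_empty Fin.elim0, Set.union_empty]
  exact hx

include hx in
/-- Members of the system lie in `𝔪_R`. [folklore] -/
theorem rsop_mem_maximalIdeal (i : Fin 3) : x i ∈ maximalIdeal (Rg p) := (isRsopPart_of_span_eq hx).mem_maximalIdeal i

include hx in
/-- Members of the system have order exactly `1`. [folklore] -/
theorem ordVK_rsop (i : Fin 3) : ordVK p (x i : K p) = expNeg 1 :=
  ordVK_eq_expNeg_one_of_not_mem_sq p ((isRsopPart_of_span_eq hx).mem_maximalIdeal i)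
    ((isRsopPart_of_span_eq hx).not_mem_sq i)

include hx in
/-- Members of the system are nonzero in `K`. [folklore] -/
theorem coe_rsop_ne_zero (i : Fin 3) : (x i : K p) ≠ 0 := by
  intro e
  have := ordVK_rsop hx i
  rw [e, map_zero] at this
  exact (expNeg_ne_zero 1) this.symm

end rsop

/-! ## 2. The chart `R[v/u₀]` and the curve blow-up `B♯` -/

/-- `θ = v/u₀ = x₁/x₀ ∈ K`. [folklore] -/
def theta (x : Fin 3 → Rg p) : K p := (x 1 : K p) / (x 0 : K p)

/-- The chart algebra `R[v/u₀] ⊆ K` of the blowing up of `R` along `(u₀, v)`. [folklore] -/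
def chart (x : Fin 3 → Rg p) : Subring (K p) := Subring.closure ((Rg p : Set (K p)) ∪ {theta p x})

/-- The curve blow-up `B♯ = R[v/u₀]_{𝔪_O ∩ R[v/u₀]}` with respect to `O = ord_𝔪`. [folklore] -/
def Bsharp (x : Fin 3 → Rg p) : Subring (K p) := locAtCentre (chart p x) (O p)

section chart

variable {p}
variable {x : Fin 3 → Rg p} (hx : Ideal.span (Set.range x) = maximalIdeal (Rg p))

include hx in
/-- `ord θ = 0`. [folklore] -/
theorem ordVK_theta : ordVK p (theta p x) = 1 := by
  rw [theta, map_div₀, ordVK_rsop hx 1, ordVK_rsop hx 0, div_self (expNeg_ne_zero 1)]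

include hx in
/-- `x₁ = x₀ θ`. [folklore] -/
theorem coe_rsop_one_eq : (x 1 : K p) = (x 0 : K p) * theta p x := by
  rw [theta, mul_div_cancel₀ _ (coe_rsop_ne_zero hx 0)]

/-- `R ≤ R[θ]`. [folklore] -/
theorem range_le_chart : Rg p ≤ chart p x := fun _ hy => Subring.subset_closure (Or.inl hy)

/-- `θ ∈ R[θ]`. [folklore] -/
theorem theta_mem_chart : theta p x ∈ chart p x := Subring.subset_closure (Or.inr rfl)

include hx in
/-- `R[θ] ≤ O`. [folklore] -/
theorem chart_le_O : chart p x ≤ (O p).toSubring := by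
  refine Subring.closure_le.mpr (Set.union_subset (range_le_O p) ?_)
  rintro _ rfl
  change theta p x ∈ O p
  rw [mem_O_iff, ordVK_theta hx]

/-- `R[θ] ≤ B♯`. [folklore] -/
theorem chart_le_Bsharp : chart p x ≤ Bsharp p x := le_locAtCentre _ _

/-- `R ≤ B♯`. [folklore] -/
theorem range_le_Bsharp : Rg p ≤ Bsharp p x := range_le_chart.trans chart_le_Bsharp

include hx in
/-- `B♯ ≤ O`. [folklore] -/
theorem Bsharp_le_O : Bsharp p x ≤ (O p).toSubring := locAtCentre_le (chart_le_O hx)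

/-- `B♯` is its own localisation at the centre. [folklore] -/
theorem locAtCentre_Bsharp : locAtCentre (Bsharp p x) (O p) = Bsharp p x := locAtCentre_locAtCentre _ _

include hx in
/-- `B♯` is a local ring. [folklore] -/
theorem isLocalRing_Bsharp : IsLocalRing (Bsharp p x) := isLocalRing_locAtCentre (chart_le_O hx)

include hx in
/-- DOMINATION: the maximal ideal of `B♯` is `{ord > 0}`. [folklore] -/
theorem mem_maximalIdeal_Bsharp_iff [IsLocalRing (Bsharp p x)] (t : Bsharp p x) :
    t ∈ maximalIdeal (Bsharp p x) ↔ ordVK p (t : K p) < 1 := by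
  rw [mem_maximalIdeal_iff_valuation_lt_one (X := Bsharp p x) (Bsharp_le_O hx) locAtCentre_Bsharp t,
    valuation_O_lt_one_iff]

include hx in
/-- Elements of `B♯` have value `≤ 1`. [folklore] -/
theorem ordVK_Bsharp_le_one (t : Bsharp p x) : ordVK p (t : K p) ≤ 1 := (mem_O_iff p _).mp (Bsharp_le_O hx t.2)

/-- `R[θ]` is the `R`-algebra generated by `θ`. [folklore] -/
theorem chart_eq_adjoin : chart p x = (Algebra.adjoin (Rg p) {theta p x}).toSubring := by
  rw [chart, Algebra.adjoin_eq_ring_closure]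
  congr 2
  exact (Set.ext fun t => ⟨fun ht => ⟨⟨t, ht⟩, rfl⟩, fun ⟨s, hs⟩ => hs ▸ s.2⟩)

/-- **Every element of `R[θ]` is a polynomial in `θ` over `R`.** [folklore] -/
theorem exists_aeval_of_mem_chart {y : K p} (hy : y ∈ chart p x) :
    ∃ f : Polynomial (Rg p), Polynomial.aeval (theta p x) f = y := by
  rw [chart_eq_adjoin] at hy
  change y ∈ Algebra.adjoin (Rg p) {theta p x} at hy
  rw [Algebra.adjoin_singleton_eq_range_aeval] at hy
  exact hy

/-- Polynomials in `θ` lie in `R[θ]`. [folklore] -/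
theorem aeval_mem_chart (f : Polynomial (Rg p)) : Polynomial.aeval (theta p x) f ∈ chart p x := by
  have : Polynomial.aeval (theta p x) f ∈ Algebra.adjoin (Rg p) {theta p x} := by
    rw [Algebra.adjoin_singleton_eq_range_aeval]; exact ⟨f, rfl⟩
  rw [chart_eq_adjoin]
  exact this

/-! ## 3. Homogenisation and quasi-regularity in the chart -/

/-- The exponent of the monomial `X₁^i X₀^{N-i}`. [folklore] -/
def expo (N i : ℕ) : Fin 3 →₀ ℕ := Finsupp.single 1 i + Finsupp.single 0 (N - i)

omit hp in
/-- `X₁^i X₀^{N-i}` has degree `N` (`i ≤ N`). [folklore] -/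
theorem degree_expo {N i : ℕ} (hi : i ≤ N) : (expo N i).degree = N := by
  rw [expo, map_add, Finsupp.degree_single, Finsupp.degree_single]
  omega

omit hp in
/-- The exponents `X₁^i X₀^{N-i}`, `i ≤ N`, are distinct. [folklore] -/
theorem expo_injective {N i j : ℕ} (h : expo N i = expo N j) : i = j := by
  have := Finsupp.ext_iff.mp h 1
  simpa [expo, Finsupp.single_apply] using this

omit hp in
/-- The exponents `X₁^i X₀^{N-i}` do not involve `X₂`. [folklore] -/
theorem expo_two (N i : ℕ) : expo N i 2 = 0 := by
  simp [expo]

/-- **Homogenisation**: `homog N f = Σ_{i ≤ N} fᵢ X₁^i X₀^{N-i} ∈ R[X₀,X₁,X₂]`. [folklore] -/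
def homog (N : ℕ) (f : Polynomial (Rg p)) : MvPolynomial (Fin 3) (Rg p) :=
  ∑ i ∈ Finset.range (N + 1), monomial (expo N i) (f.coeff i)

/-- `homog N f` is a form of degree `N`. [folklore] -/
theorem isHomogeneous_homog (N : ℕ) (f : Polynomial (Rg p)) : (homog N f).IsHomogeneous N := by
  refine IsHomogeneous.sum _ _ _ fun i hi => isHomogeneous_monomial _ (degree_expo ?_)
  exact Nat.lt_succ_iff.mp (Finset.mem_range.mp hi)

/-- The coefficient of `X₁^j X₀^{N-j}` in `homog N f` is `f_j`. [folklore] -/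
theorem coeff_homog {N j : ℕ} (hj : j ≤ N) (f : Polynomial (Rg p)) : coeff (expo N j) (homog N f) = f.coeff j := by
  classical
  rw [homog, coeff_sum, Finset.sum_eq_single j]
  · rw [coeff_monomial, if_pos rfl]
  · intro i _ hij
    rw [coeff_monomial, if_neg]
    exact fun h => hij (expo_injective h)
  · intro h
    exact absurd (Finset.mem_range.mpr (Nat.lt_succ_of_le hj)) h

/-- Monomials involving `X₂` do not occur in `homog N f`. [folklore] -/
theorem coeff_homog_eq_zero {N : ℕ} (f : Polynomial (Rg p)) {m : Fin 3 →₀ ℕ} (hm : m 2 ≠ 0) :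
    coeff m (homog N f) = 0 := by
  classical
  rw [homog, coeff_sum]
  refine Finset.sum_eq_zero fun i _ => ?_
  rw [coeff_monomial, if_neg]
  intro h
  apply hm
  rw [← h, expo_two]

include hx in
/-- **`u₀^N · f(θ) = (homog N f)(u₀, v, w)`** for `deg f ≤ N`. [folklore] -/
theorem coe_eval_homog {N : ℕ} {f : Polynomial (Rg p)} (hf : f.natDegree ≤ N) :
    ((eval x (homog N f) : Rg p) : K p) = (x 0 : K p) ^ N * Polynomial.aeval (theta p x) f := by
  have h0 := coe_rsop_ne_zero hx 0
  rw [Polynomial.aeval_eq_sum_range' (Nat.lt_succ_of_le hf), homog, map_sum, Finset.mul_sum]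
  change (Rg p).subtype _ = _
  rw [map_sum]
  refine Finset.sum_congr rfl fun i hi => ?_
  have hi' : i ≤ N := Nat.lt_succ_iff.mp (Finset.mem_range.mp hi)
  rw [eval_monomial, expo, Finsupp.prod_add_index' (fun _ => pow_zero _) (fun _ _ _ => pow_add _ _ _)]
  simp only [Finsupp.prod_single_index, pow_zero, map_mul, map_pow, Subring.subtype_apply, Subring.smul_def, smul_eq_mul,
    theta, div_pow]
  have hsplit : (x 0 : K p) ^ N = (x 0 : K p) ^ (N - i) * (x 0 : K p) ^ i := by rw [← pow_add, Nat.sub_add_cancel hi']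
  rw [hsplit]
  field_simp

include hx in
/-- **Quasi-regularity in the chart**: if `ord f(θ) > 0` then every coefficient of `f` lies in `𝔪_R` (the form
`u₀^N f(θ)` of degree `N` lies in `𝔪^{N+1}`; Matsumura 17.10). [folklore] -/
theorem coeff_mem_maximalIdeal_of_ordVK_aeval_lt_one {f : Polynomial (Rg p)}
    (h : ordVK p (Polynomial.aeval (theta p x) f) < 1) (i : ℕ) : f.coeff i ∈ maximalIdeal (Rg p) := by
  set N := f.natDegree with hN
  by_cases hi : i ≤ N
  · have hy : eval x (homog N f) ∈ maximalIdeal (Rg p) ^ (N + 1) := by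
      apply mem_pow_of_ordVK_le_expNeg
      rw [coe_eval_homog hx le_rfl, map_mul, map_pow, ordVK_rsop hx 0, expNeg_one_pow, expNeg_add]
      exact mul_le_mul' le_rfl (lt_one_iff_le_expNeg_one.mp h)
    have := coeff_mem_maximalIdeal_of_eval_mem_pow (spanFinrank_maximalIdeal_range p) x hx
      (isHomogeneous_homog N f) hy (expo N i)
    rwa [coeff_homog hi] at this
  · rw [Polynomial.coeff_eq_zero_of_natDegree_lt (not_le.mp hi)]
    exact zero_mem _

include hx in
/-- Conversely, a polynomial with all coefficients in `𝔪_R` has `ord f(θ) > 0`. [folklore] -/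
theorem ordVK_aeval_lt_one_of_coeff_mem {f : Polynomial (Rg p)} (h : ∀ i, f.coeff i ∈ maximalIdeal (Rg p)) :
    ordVK p (Polynomial.aeval (theta p x) f) < 1 := by
  rw [Polynomial.aeval_eq_sum_range]
  refine Valuation.map_sum_lt _ one_ne_zero fun i _ => ?_
  rw [Algebra.smul_def, map_mul, map_pow, ordVK_theta hx, one_pow, mul_one]
  exact (mem_maximalIdeal_range_iff p _).mp (h i)

include hx in
/-- `f(θ) ∈ O` for every `f ∈ R[T]`. [folklore] -/
theorem ordVK_aeval_le_one (f : Polynomial (Rg p)) : ordVK p (Polynomial.aeval (theta p x) f) ≤ 1 := by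
  rw [Polynomial.aeval_eq_sum_range]
  refine Valuation.map_sum_le _ fun i _ => ?_
  rw [Algebra.smul_def, map_mul, map_pow, ordVK_theta hx, one_pow, mul_one]
  exact ordVK_range_le_one p _

include hx in
/-- **A polynomial with a unit coefficient has `ord f(θ) = 0`** (the residue of `θ` is transcendental over the prime field).
[folklore] -/
theorem ordVK_aeval_eq_one_of_not_mem {f : Polynomial (Rg p)} {i : ℕ} (hi : f.coeff i ∉ maximalIdeal (Rg p)) :
    ordVK p (Polynomial.aeval (theta p x) f) = 1 := by
  refine le_antisymm (ordVK_aeval_le_one hx f) ?_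
  by_contra hlt
  exact hi (coeff_mem_maximalIdeal_of_ordVK_aeval_lt_one hx (not_le.mp hlt) i)

end chart

end OrdWitness

end Summit.ResolutionOfSingularities.ResolutionOfSingularities.Theorems.CleanModels.Negative

end
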